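/-
Cell b2b-lgcu-borel (gen 21).  VALUE = THEOREM (a law on every hypothetical witness + an exclusion),
NOT summit progress; the crux item `SubgroupIdentityDesigns` (stmt-14079) stays open and untouched.
-/
import Mathlib
import Summits.MatrixMultiplication.MatrixMultiplication.Theorems.SubgroupIdentityDesigns.Negative.LevelOneEquivariantDim
import Summits.MatrixMultiplication.MatrixMultiplication.Theorems.SubgroupIdentityDesigns.Negative.SemiregularLaw
import Summits.MatrixMultiplication.MatrixMultiplication.Theorems.SubgroupIdentityDesigns.Negative.LevelOneWindowAll

/-!
# The character law for level-one witnesses, and the single-admissible-orbit exclusion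

Route `LevelGradedCohnUmans`, crux `SubgroupIdentityDesigns` (stmt-MatrixMultiplication-14079), cells
`(m, k) = (1 + l, 1)`; report `run/shared/lean/b2b/levelgraded-cu/ORACLE-g21.md` §G21-3.  VALUE =
THEOREM (an all-`p`, all-`m`, all-`ε` law on hypothetical witnesses and an unconditional exclusion of a
class of members), NOT summit progress; the crux item is untouched and remains open.

## The character law (`x, y, z = |H₁|, |H₂|, |H₃|`, `b = #ℙ^{m-1}(𝔽_p)`)

Combine the twisted module law (`TwistedModuleLaw`: `(x + y − 1)·[H₃ : K] ≤ dim (F_1)_σ`) with the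
equivariant dimension bound (`LevelOneEquivariantDim`: `dim (F_1)_σ ≤ ν_σ(K) · b`, `ν_σ(K)` = number
of `K`-orbits on vectors whose stabiliser lies in `ker σ`): for every level-one witness, every
subgroup `K` of a member and every NON-TRIVIAL linear character `σ` of `K`,

* `law_right`  (`K ≤ H₃`): `(x + y − 1) · [H₃ : K] ≤ ν_σ(K) · b`,
* `law_left`   (`K ≤ H₁`): `(z + y − 1) · [H₁ : K] ≤ ν_σ(K) · b` (reversal, `SemiregularLaw`),
* `law_middle` (`K ≤ H₂`): `x · [H₂ : K] ≤ ν_σ(K) · b` and `z · [H₂ : K] ≤ ν_σ(K) · b`,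

with multiplied-out forms (primed) and crux forms (`crux_law_*`).  The invariant law of gen 20 (`σ = 1`)
counts ALL orbits and is empty for subgroups rich in fixed points; here orbits met by `σ(k) ≠ 1` drop out.

## The single-admissible-orbit exclusion (`p ≥ 3`, `m = 1 + l ≥ 2`, `−2 < ε ≤ 1`)

`no_single_orbit_right/left/middle`: NO member of a level-one witness contains a subgroup `K` carrying
a character `σ ≠ 1` with `ν_σ(K) ≤ 1`.  Ends: the window `x, y ≥ b` (`LevelOneWindowAll`) and `|K| ≤ z`
give `(2b − 1) z ≤ (x + y − 1) z ≤ |K| b ≤ z b`, absurd.  Middle: `x y ≤ |K| ν b ≤ y b` forces `x ≤ b`,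
likewise `z ≤ b`, so `x = z = b` by the window; then the Neumann count `b (b + y − 1) ≤ dim F_1 ≤
(p−1) b² − 2b + 2` caps `y ≤ (p−2) b − 1` while the volume floor `(p−1) b³ + 3b + 1 ≤ b² y + 3b²`
(`LevelOneFloorAll`) needs `y > (p−1) b − 3` — absurd for `b ≥ 2`.
Corollaries: `two_le_card_admOrb_member` — EVERY member `Hᵢ` has `ν_σ(Hᵢ) ≥ 2` for each of its
non-trivial linear characters; `index_rigidity` — an end member containing `K` with `σ ≠ 1`,
`ν_σ(K) ≤ 3` EQUALS `K`, and `[H₂ : K] ≤ ν_σ(K)` for `K ≤ H₂`.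
Instances (sequel `DiagonalTorusExclusion`): the diagonal torus (and its conjugates) with
`σ = χ ∘ det`, `χ ≠ 1`, has `ν_σ = 1`; `ν_σ = 0` (no admissible vector) is excluded a fortiori.

Sorry-free; standard axioms.
-/

set_option linter.dupNamespace false

noncomputable section

open scoped BigOperators Classical Matrix LinearAlgebra.Projectivization
open Module (finrank)

namespace Summit.MatrixMultiplication.MatrixMultiplication.Theorems.SubgroupIdentityDesigns.Negative
namespace CharacterLaw

open Summit.MatrixMultiplication.MatrixMultiplication.Theorems.LieRankDesigns.Negative (GLm Mat budget)
open Summit.MatrixMultiplication.MatrixMultiplication.Theorems.LevelOneGL2Designs.Negative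
  (levelSubmodule levelSubmodule_bi_inv)
open Literature.Barriers.MatrixMultiplication (SubgroupTPP)
open TwistedModuleLaw (eqvRight index_mul_le_finrank_eqvRight card_mul_le_card_mul_finrank_eqvRight
  card_mul_index_le_finrank_eqvRight_middle card_mul_card_le_finrank_eqvRight_middle)
open LevelOneEquivariantDim (adm AdmOrb finrank_eqvRight_levelOne_le)
open SemiregularLaw (tpp_reverse test_reverse comp_inv_mem)
open PackingBridge (exists_test)
open WitnessNeumannCounts (crux_neumann one_le_card)
open LevelOneFloorAll (volume_gt_floor_nat finrank_le_formula_nat succ_le_b)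
open LevelOneWindowAll (levelOne_member_window)
open LevelOneDim (card_proj_mul)

variable {p m : ℕ} [hp : Fact p.Prime]

/-! ## The laws (abstract identity test `f ∈ F_1`) -/

section Laws

variable {H₁ H₂ H₃ : Subgroup (GLm p m)} {f : GLm p m → ℂ} {K : Subgroup (GLm p m)} {σ : K →* ℂˣ}

/-- **CHARACTER LAW, third member:** `(x + y − 1) · [H₃ : K] ≤ ν_σ(K) · b` (`K ≤ H₃`, `σ ≠ 1`). -/
theorem law_right (htpp : SubgroupTPP H₁ H₂ H₃) (hf : f ∈ levelSubmodule p m 1) (h1 : f 1 = 1)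
    (h0 : ∀ a ∈ H₁, ∀ b ∈ H₂, ∀ c ∈ H₃, a * b * c ≠ 1 → f (a * b * c) = 0)
    (hK : K ≤ H₃) (hσ : σ ≠ 1) :
    (Nat.card H₁ + (Nat.card H₂ - 1)) * K.relIndex H₃ ≤
      Nat.card (AdmOrb K σ) * Nat.card (ℙ (ZMod p) (Fin m → ZMod p)) :=
  (index_mul_le_finrank_eqvRight _ levelSubmodule_bi_inv htpp hf h1 h0 hK σ).trans
    (finrank_eqvRight_levelOne_le K hσ)

/-- Third member, multiplied out: `(x + y − 1) · z ≤ |K| · ν_σ(K) · b`. -/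
theorem law_right' (htpp : SubgroupTPP H₁ H₂ H₃) (hf : f ∈ levelSubmodule p m 1) (h1 : f 1 = 1)
    (h0 : ∀ a ∈ H₁, ∀ b ∈ H₂, ∀ c ∈ H₃, a * b * c ≠ 1 → f (a * b * c) = 0)
    (hK : K ≤ H₃) (hσ : σ ≠ 1) :
    (Nat.card H₁ + (Nat.card H₂ - 1)) * Nat.card H₃ ≤
      Nat.card K * (Nat.card (AdmOrb K σ) * Nat.card (ℙ (ZMod p) (Fin m → ZMod p))) :=
  (card_mul_le_card_mul_finrank_eqvRight _ levelSubmodule_bi_inv htpp hf h1 h0 hK σ).trans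
    (Nat.mul_le_mul_left _ (finrank_eqvRight_levelOne_le K hσ))

/-- **CHARACTER LAW, first member** (reversal): `(z + y − 1) · [H₁ : K] ≤ ν_σ(K) · b` (`K ≤ H₁`). -/
theorem law_left (htpp : SubgroupTPP H₁ H₂ H₃) (hf : f ∈ levelSubmodule p m 1) (h1 : f 1 = 1)
    (h0 : ∀ a ∈ H₁, ∀ b ∈ H₂, ∀ c ∈ H₃, a * b * c ≠ 1 → f (a * b * c) = 0)
    (hK : K ≤ H₁) (hσ : σ ≠ 1) :
    (Nat.card H₃ + (Nat.card H₂ - 1)) * K.relIndex H₁ ≤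
      Nat.card (AdmOrb K σ) * Nat.card (ℙ (ZMod p) (Fin m → ZMod p)) :=
  law_right (tpp_reverse htpp) (comp_inv_mem hf) (by simp only [inv_one]; exact h1)
    (test_reverse h0) hK hσ

/-- First member, multiplied out: `(z + y − 1) · x ≤ |K| · ν_σ(K) · b`. -/
theorem law_left' (htpp : SubgroupTPP H₁ H₂ H₃) (hf : f ∈ levelSubmodule p m 1) (h1 : f 1 = 1)
    (h0 : ∀ a ∈ H₁, ∀ b ∈ H₂, ∀ c ∈ H₃, a * b * c ≠ 1 → f (a * b * c) = 0)
    (hK : K ≤ H₁) (hσ : σ ≠ 1) :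
    (Nat.card H₃ + (Nat.card H₂ - 1)) * Nat.card H₁ ≤
      Nat.card K * (Nat.card (AdmOrb K σ) * Nat.card (ℙ (ZMod p) (Fin m → ZMod p))) :=
  law_right' (tpp_reverse htpp) (comp_inv_mem hf) (by simp only [inv_one]; exact h1)
    (test_reverse h0) hK hσ

/-- **CHARACTER LAW, middle member:** `x · [H₂ : K] ≤ ν_σ(K) · b` (`K ≤ H₂`, `σ ≠ 1`). -/
theorem law_middle (htpp : SubgroupTPP H₁ H₂ H₃) (hf : f ∈ levelSubmodule p m 1) (h1 : f 1 = 1)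
    (h0 : ∀ a ∈ H₁, ∀ b ∈ H₂, ∀ c ∈ H₃, a * b * c ≠ 1 → f (a * b * c) = 0)
    (hK : K ≤ H₂) (hσ : σ ≠ 1) :
    Nat.card H₁ * K.relIndex H₂ ≤
      Nat.card (AdmOrb K σ) * Nat.card (ℙ (ZMod p) (Fin m → ZMod p)) :=
  (card_mul_index_le_finrank_eqvRight_middle _ levelSubmodule_bi_inv htpp hf h1 h0 hK σ).trans
    (finrank_eqvRight_levelOne_le K hσ)

/-- Middle member, multiplied out: `x · y ≤ |K| · ν_σ(K) · b`. -/
theorem law_middle' (htpp : SubgroupTPP H₁ H₂ H₃) (hf : f ∈ levelSubmodule p m 1) (h1 : f 1 = 1)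
    (h0 : ∀ a ∈ H₁, ∀ b ∈ H₂, ∀ c ∈ H₃, a * b * c ≠ 1 → f (a * b * c) = 0)
    (hK : K ≤ H₂) (hσ : σ ≠ 1) :
    Nat.card H₁ * Nat.card H₂ ≤
      Nat.card K * (Nat.card (AdmOrb K σ) * Nat.card (ℙ (ZMod p) (Fin m → ZMod p))) :=
  (card_mul_card_le_finrank_eqvRight_middle _ levelSubmodule_bi_inv htpp hf h1 h0 hK σ).trans
    (Nat.mul_le_mul_left _ (finrank_eqvRight_levelOne_le K hσ))

/-- Middle member seen from the other end, multiplied out: `z · y ≤ |K| · ν_σ(K) · b`. -/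
theorem law_middle_rev' (htpp : SubgroupTPP H₁ H₂ H₃) (hf : f ∈ levelSubmodule p m 1)
    (h1 : f 1 = 1) (h0 : ∀ a ∈ H₁, ∀ b ∈ H₂, ∀ c ∈ H₃, a * b * c ≠ 1 → f (a * b * c) = 0)
    (hK : K ≤ H₂) (hσ : σ ≠ 1) :
    Nat.card H₃ * Nat.card H₂ ≤
      Nat.card K * (Nat.card (AdmOrb K σ) * Nat.card (ℙ (ZMod p) (Fin m → ZMod p))) :=
  law_middle' (tpp_reverse htpp) (comp_inv_mem hf) (by simp only [inv_one]; exact h1)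
    (test_reverse h0) hK hσ

end Laws

/-! ## Crux forms (hypotheses = the crux clauses at level `1`, any `ε`) -/

section Crux

variable {H₁ H₂ H₃ : Subgroup (GLm p m)} {K : Subgroup (GLm p m)} {σ : K →* ℂˣ}

/-- **CHARACTER LAW for the crux, third member:** `(x + y − 1) · [H₃ : K] ≤ ν_σ(K) · b`. -/
theorem crux_law_right (htpp : SubgroupTPP H₁ H₂ H₃)
    (hdes : ∃ c : Mat p m → ℂ, (∀ M, 1 < M.rank → c M = 0) ∧
      (∑ M, c M * ZMod.stdAddChar (Matrix.trace (M * ((1 : GLm p m) : Mat p m)))) = 1 ∧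
      ∀ a ∈ H₁, ∀ b ∈ H₂, ∀ g ∈ H₃, a * b * g ≠ 1 →
        (∑ M, c M * ZMod.stdAddChar (Matrix.trace (M * ((a * b * g : GLm p m) : Mat p m)))) = 0)
    (hK : K ≤ H₃) (hσ : σ ≠ 1) :
    (Nat.card H₁ + (Nat.card H₂ - 1)) * K.relIndex H₃ ≤
      Nat.card (AdmOrb K σ) * Nat.card (ℙ (ZMod p) (Fin m → ZMod p)) := by
  obtain ⟨f, hf, h1, h0⟩ := exists_test hdes
  exact law_right htpp hf h1 h0 hK hσ

/-- Crux form, third member, multiplied out: `(x + y − 1) z ≤ |K| ν_σ(K) b`. -/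
theorem crux_law_right' (htpp : SubgroupTPP H₁ H₂ H₃)
    (hdes : ∃ c : Mat p m → ℂ, (∀ M, 1 < M.rank → c M = 0) ∧
      (∑ M, c M * ZMod.stdAddChar (Matrix.trace (M * ((1 : GLm p m) : Mat p m)))) = 1 ∧
      ∀ a ∈ H₁, ∀ b ∈ H₂, ∀ g ∈ H₃, a * b * g ≠ 1 →
        (∑ M, c M * ZMod.stdAddChar (Matrix.trace (M * ((a * b * g : GLm p m) : Mat p m)))) = 0)
    (hK : K ≤ H₃) (hσ : σ ≠ 1) :
    (Nat.card H₁ + (Nat.card H₂ - 1)) * Nat.card H₃ ≤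
      Nat.card K * (Nat.card (AdmOrb K σ) * Nat.card (ℙ (ZMod p) (Fin m → ZMod p))) := by
  obtain ⟨f, hf, h1, h0⟩ := exists_test hdes
  exact law_right' htpp hf h1 h0 hK hσ

/-- Crux form, first member, multiplied out: `(z + y − 1) x ≤ |K| ν_σ(K) b`. -/
theorem crux_law_left' (htpp : SubgroupTPP H₁ H₂ H₃)
    (hdes : ∃ c : Mat p m → ℂ, (∀ M, 1 < M.rank → c M = 0) ∧
      (∑ M, c M * ZMod.stdAddChar (Matrix.trace (M * ((1 : GLm p m) : Mat p m)))) = 1 ∧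
      ∀ a ∈ H₁, ∀ b ∈ H₂, ∀ g ∈ H₃, a * b * g ≠ 1 →
        (∑ M, c M * ZMod.stdAddChar (Matrix.trace (M * ((a * b * g : GLm p m) : Mat p m)))) = 0)
    (hK : K ≤ H₁) (hσ : σ ≠ 1) :
    (Nat.card H₃ + (Nat.card H₂ - 1)) * Nat.card H₁ ≤
      Nat.card K * (Nat.card (AdmOrb K σ) * Nat.card (ℙ (ZMod p) (Fin m → ZMod p))) := by
  obtain ⟨f, hf, h1, h0⟩ := exists_test hdes
  exact law_left' htpp hf h1 h0 hK hσ

/-- Crux form, middle member, multiplied out: `x y ≤ |K| ν_σ(K) b` and `z y ≤ |K| ν_σ(K) b`. -/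
theorem crux_law_middle' (htpp : SubgroupTPP H₁ H₂ H₃)
    (hdes : ∃ c : Mat p m → ℂ, (∀ M, 1 < M.rank → c M = 0) ∧
      (∑ M, c M * ZMod.stdAddChar (Matrix.trace (M * ((1 : GLm p m) : Mat p m)))) = 1 ∧
      ∀ a ∈ H₁, ∀ b ∈ H₂, ∀ g ∈ H₃, a * b * g ≠ 1 →
        (∑ M, c M * ZMod.stdAddChar (Matrix.trace (M * ((a * b * g : GLm p m) : Mat p m)))) = 0)
    (hK : K ≤ H₂) (hσ : σ ≠ 1) :
    Nat.card H₁ * Nat.card H₂ ≤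
        Nat.card K * (Nat.card (AdmOrb K σ) * Nat.card (ℙ (ZMod p) (Fin m → ZMod p))) ∧
      Nat.card H₃ * Nat.card H₂ ≤
        Nat.card K * (Nat.card (AdmOrb K σ) * Nat.card (ℙ (ZMod p) (Fin m → ZMod p))) := by
  obtain ⟨f, hf, h1, h0⟩ := exists_test hdes
  exact ⟨law_middle' htpp hf h1 h0 hK hσ, law_middle_rev' htpp hf h1 h0 hK hσ⟩

end Crux

/-! ## The single-admissible-orbit exclusion -/

section Arith

/-- End-member arithmetic: `x, y ≥ b ≥ 2`, `c ≤ z`, `n ≤ 1` and `(x + y − 1) z ≤ c n b` is absurd. -/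
theorem arith_end {x y z c n b : ℕ} (hb : 2 ≤ b) (hx : b ≤ x) (hy : b ≤ y) (hz : 1 ≤ z)
    (hc : c ≤ z) (hn : n ≤ 1) (h : (x + (y - 1)) * z ≤ c * (n * b)) : False := by
  obtain ⟨y', rfl⟩ : ∃ y', y = y' + 1 := ⟨y - 1, by omega⟩
  rw [Nat.add_sub_cancel] at h
  have h1 : c * (n * b) ≤ z * (1 * b) := Nat.mul_le_mul hc (Nat.mul_le_mul_right _ hn)
  have h3 : (b + 1) * z ≤ (x + y') * z := Nat.mul_le_mul_right _ (by omega)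
  nlinarith

/-- Middle-member cancellation: `x y ≤ c n b` with `c ≤ y`, `n ≤ 1`, `y ≥ 1` gives `x ≤ b`. -/
theorem le_of_middle_law {x y c n b : ℕ} (hy : 1 ≤ y) (hc : c ≤ y) (hn : n ≤ 1)
    (h : x * y ≤ c * (n * b)) : x ≤ b := by
  have h1 : c * (n * b) ≤ y * (1 * b) := Nat.mul_le_mul hc (Nat.mul_le_mul_right _ hn)
  rw [one_mul] at h1
  exact Nat.le_of_mul_le_mul_right (h.trans (h1.trans_eq (mul_comm y b))) hy

/-- Middle-member arithmetic: with `x = z = b ≥ 4`, the Neumann count `b² + b (y − 1) ≤ D`, the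
dimension formula `D + 2b ≤ P b² + 2` and the volume floor `P b³ + 3b + 1 ≤ b y b + 3b²` clash. -/
theorem arith_middle {P b y D : ℕ} (hb : 4 ≤ b) (hy : 1 ≤ y) (hN1 : b * b + b * (y - 1) ≤ D)
    (hD : D + 2 * b ≤ P * b ^ 2 + 2) (hF : P * b ^ 3 + 3 * b + 1 ≤ b * y * b + 3 * b ^ 2) :
    False := by
  obtain ⟨y', rfl⟩ : ∃ y', y = y' + 1 := ⟨y - 1, by omega⟩
  rw [Nat.add_sub_cancel] at hN1
  have h2 : b * (b * b + b * y' + 2 * b) ≤ b * (P * b ^ 2 + 2) :=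
    Nat.mul_le_mul_left b (le_trans (Nat.add_le_add_right hN1 (2 * b)) hD)
  have hb3 : b * b * 4 ≤ b * b * b := Nat.mul_le_mul_left _ hb
  nlinarith

/-- `#ℙ^{l}(𝔽_p) = (p^{1+l} − 1)/(p − 1)` as natural numbers. -/
theorem card_proj_eq (l : ℕ) :
    Nat.card (ℙ (ZMod p) (Fin (1 + l) → ZMod p)) = (p ^ (1 + l) - 1) / (p - 1) := by
  have h := card_proj_mul (p := p) (m := 1 + l)
  have hp1 : 0 < p - 1 := by have := hp.out.two_le; omega
  exact (Nat.div_eq_of_eq_mul_left hp1 h.symm).symm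

end Arith

section Exclusion

variable {l : ℕ} {H₁ H₂ H₃ : Subgroup (GLm p (1 + l))} {K : Subgroup (GLm p (1 + l))} {σ : K →* ℂˣ}

/-- **SINGLE-ADMISSIBLE-ORBIT EXCLUSION, third member.**  In a level-one witness (`p ≥ 3`,
`m = 1 + l ≥ 2`, `−2 < ε ≤ 1`) no subgroup `K ≤ H₃` carries a character `σ ≠ 1` with `ν_σ(K) ≤ 1`. -/
theorem no_single_orbit_right (hl : 1 ≤ l) (hp3 : 3 ≤ p) {ε : ℝ} (hε : -2 < ε) (hε1 : ε ≤ 1)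
    (htpp : SubgroupTPP H₁ H₂ H₃)
    (hdes : ∃ c : Mat p (1 + l) → ℂ, (∀ M, 1 < M.rank → c M = 0) ∧
      (∑ M, c M * ZMod.stdAddChar (Matrix.trace (M * ((1 : GLm p (1 + l)) : Mat p (1 + l))))) = 1 ∧
      ∀ a ∈ H₁, ∀ b ∈ H₂, ∀ g ∈ H₃, a * b * g ≠ 1 →
        (∑ M, c M * ZMod.stdAddChar
          (Matrix.trace (M * ((a * b * g : GLm p (1 + l)) : Mat p (1 + l))))) = 0)
    (hlt : budget p (1 + l) 1 (2 + ε) <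
      ((Nat.card H₁ * Nat.card H₂ * Nat.card H₃ : ℕ) : ℝ) ^ ((2 + ε) / 3))
    (hK : K ≤ H₃) (hσ : σ ≠ 1) (hν : Nat.card (AdmOrb K σ) ≤ 1) : False := by
  obtain ⟨⟨hxb, -, -⟩, ⟨hyb, -⟩, ⟨hzb, -, -⟩⟩ := levelOne_member_window hl hp3 hε hε1 htpp hdes hlt
  have hlaw := crux_law_right' htpp hdes hK hσ
  rw [card_proj_eq] at hlaw
  have hbp := succ_le_b (p := p) hl
  exact arith_end (by omega) hxb hyb (by omega) (Subgroup.card_le_of_le hK) hν hlaw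

/-- **SINGLE-ADMISSIBLE-ORBIT EXCLUSION, first member** (`K ≤ H₁`, `σ ≠ 1`, `ν_σ(K) ≤ 1`). -/
theorem no_single_orbit_left (hl : 1 ≤ l) (hp3 : 3 ≤ p) {ε : ℝ} (hε : -2 < ε) (hε1 : ε ≤ 1)
    (htpp : SubgroupTPP H₁ H₂ H₃)
    (hdes : ∃ c : Mat p (1 + l) → ℂ, (∀ M, 1 < M.rank → c M = 0) ∧
      (∑ M, c M * ZMod.stdAddChar (Matrix.trace (M * ((1 : GLm p (1 + l)) : Mat p (1 + l))))) = 1 ∧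
      ∀ a ∈ H₁, ∀ b ∈ H₂, ∀ g ∈ H₃, a * b * g ≠ 1 →
        (∑ M, c M * ZMod.stdAddChar
          (Matrix.trace (M * ((a * b * g : GLm p (1 + l)) : Mat p (1 + l))))) = 0)
    (hlt : budget p (1 + l) 1 (2 + ε) <
      ((Nat.card H₁ * Nat.card H₂ * Nat.card H₃ : ℕ) : ℝ) ^ ((2 + ε) / 3))
    (hK : K ≤ H₁) (hσ : σ ≠ 1) (hν : Nat.card (AdmOrb K σ) ≤ 1) : False := by
  obtain ⟨⟨hxb, -, -⟩, ⟨hyb, -⟩, ⟨hzb, -, -⟩⟩ := levelOne_member_window hl hp3 hε hε1 htpp hdes hlt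
  have hlaw := crux_law_left' htpp hdes hK hσ
  rw [card_proj_eq] at hlaw
  have hbp := succ_le_b (p := p) hl
  exact arith_end (by omega) hzb hyb (by omega) (Subgroup.card_le_of_le hK) hν hlaw

/-- **SINGLE-ADMISSIBLE-ORBIT EXCLUSION, middle member** (`K ≤ H₂`, `σ ≠ 1`, `ν_σ(K) ≤ 1`). -/
theorem no_single_orbit_middle (hl : 1 ≤ l) (hp3 : 3 ≤ p) {ε : ℝ} (hε : -2 < ε) (hε1 : ε ≤ 1)
    (htpp : SubgroupTPP H₁ H₂ H₃)
    (hdes : ∃ c : Mat p (1 + l) → ℂ, (∀ M, 1 < M.rank → c M = 0) ∧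
      (∑ M, c M * ZMod.stdAddChar (Matrix.trace (M * ((1 : GLm p (1 + l)) : Mat p (1 + l))))) = 1 ∧
      ∀ a ∈ H₁, ∀ b ∈ H₂, ∀ g ∈ H₃, a * b * g ≠ 1 →
        (∑ M, c M * ZMod.stdAddChar
          (Matrix.trace (M * ((a * b * g : GLm p (1 + l)) : Mat p (1 + l))))) = 0)
    (hlt : budget p (1 + l) 1 (2 + ε) <
      ((Nat.card H₁ * Nat.card H₂ * Nat.card H₃ : ℕ) : ℝ) ^ ((2 + ε) / 3))
    (hK : K ≤ H₂) (hσ : σ ≠ 1) (hν : Nat.card (AdmOrb K σ) ≤ 1) : False := by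
  obtain ⟨⟨hxb, -, -⟩, ⟨hyb, -⟩, ⟨hzb, -, -⟩⟩ := levelOne_member_window hl hp3 hε hε1 htpp hdes hlt
  obtain ⟨hlx, hlz⟩ := crux_law_middle' htpp hdes hK hσ
  rw [card_proj_eq] at hlx hlz
  have hKy : Nat.card K ≤ Nat.card H₂ := Subgroup.card_le_of_le hK
  have hy1 : 1 ≤ Nat.card H₂ := one_le_card H₂
  have hx : Nat.card H₁ = (p ^ (1 + l) - 1) / (p - 1) :=
    le_antisymm (le_of_middle_law hy1 hKy hν hlx) hxb
  have hz : Nat.card H₃ = (p ^ (1 + l) - 1) / (p - 1) :=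
    le_antisymm (le_of_middle_law hy1 hKy hν hlz) hzb
  obtain ⟨N1, -⟩ := crux_neumann (k := 1) htpp hdes
  have hF := volume_gt_floor_nat (p := p) hl hε hε1 hlt
  have hD := finrank_le_formula_nat (p := p) (l := l)
  have hbp := succ_le_b (p := p) hl
  rw [hx, hz] at N1 hF
  exact arith_middle (by omega) hy1 N1 hD hF


/-! ## Corollaries for the members themselves (`K = Hᵢ`) and index rigidity -/

/-- **EVERY MEMBER HAS AT LEAST TWO ADMISSIBLE ORBITS FOR EACH OF ITS NON-TRIVIAL CHARACTERS**:
`ν_σ(Hᵢ) ≥ 2` for `i = 1, 2, 3` and every linear character `σ ≠ 1` of `Hᵢ` (level one, `p ≥ 3`,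
`m = 1 + l ≥ 2`, `−2 < ε ≤ 1`). -/
theorem two_le_card_admOrb_member (hl : 1 ≤ l) (hp3 : 3 ≤ p) {ε : ℝ} (hε : -2 < ε) (hε1 : ε ≤ 1)
    (htpp : SubgroupTPP H₁ H₂ H₃)
    (hdes : ∃ c : Mat p (1 + l) → ℂ, (∀ M, 1 < M.rank → c M = 0) ∧
      (∑ M, c M * ZMod.stdAddChar (Matrix.trace (M * ((1 : GLm p (1 + l)) : Mat p (1 + l))))) = 1 ∧
      ∀ a ∈ H₁, ∀ b ∈ H₂, ∀ g ∈ H₃, a * b * g ≠ 1 →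
        (∑ M, c M * ZMod.stdAddChar
          (Matrix.trace (M * ((a * b * g : GLm p (1 + l)) : Mat p (1 + l))))) = 0)
    (hlt : budget p (1 + l) 1 (2 + ε) <
      ((Nat.card H₁ * Nat.card H₂ * Nat.card H₃ : ℕ) : ℝ) ^ ((2 + ε) / 3)) :
    (∀ σ₁ : H₁ →* ℂˣ, σ₁ ≠ 1 → 2 ≤ Nat.card (AdmOrb H₁ σ₁)) ∧
      (∀ σ₂ : H₂ →* ℂˣ, σ₂ ≠ 1 → 2 ≤ Nat.card (AdmOrb H₂ σ₂)) ∧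
      (∀ σ₃ : H₃ →* ℂˣ, σ₃ ≠ 1 → 2 ≤ Nat.card (AdmOrb H₃ σ₃)) := by
  refine ⟨fun σ₁ h1 => ?_, fun σ₂ h2 => ?_, fun σ₃ h3 => ?_⟩ <;> by_contra hlt2 <;> rw [not_le] at hlt2
  · exact no_single_orbit_left hl hp3 hε hε1 htpp hdes hlt le_rfl h1 (by omega)
  · exact no_single_orbit_middle hl hp3 hε hε1 htpp hdes hlt le_rfl h2 (by omega)
  · exact no_single_orbit_right hl hp3 hε hε1 htpp hdes hlt le_rfl h3 (by omega)

/-- Index arithmetic: `(x + y − 1) r ≤ n b` with `x, y ≥ b ≥ 4`, `n ≤ 3` forces `r ≤ 1`. -/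
theorem arith_rigid {x y r n b : ℕ} (hb : 4 ≤ b) (hx : b ≤ x) (hy : b ≤ y) (hn : n ≤ 3)
    (h : (x + (y - 1)) * r ≤ n * b) : r ≤ 1 := by
  by_contra hr
  have hr2 : 2 ≤ r := by omega
  set s := x + (y - 1) with hs_def
  have hs : 2 * b ≤ s + 1 := by omega
  have h2 : s * 2 ≤ s * r := Nat.mul_le_mul_left _ hr2
  have h3 : n * b ≤ 3 * b := Nat.mul_le_mul_right _ hn
  nlinarith

/-- **INDEX RIGIDITY.**  If an END member contains a subgroup `K` carrying a character `σ ≠ 1`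
with `ν_σ(K) ≤ 3`, then `K` IS that member; a subgroup `K` of the MIDDLE member with a character
`σ ≠ 1` has index `[H₂ : K] ≤ ν_σ(K)`. -/
theorem index_rigidity (hl : 1 ≤ l) (hp3 : 3 ≤ p) {ε : ℝ} (hε : -2 < ε) (hε1 : ε ≤ 1)
    (htpp : SubgroupTPP H₁ H₂ H₃)
    (hdes : ∃ c : Mat p (1 + l) → ℂ, (∀ M, 1 < M.rank → c M = 0) ∧
      (∑ M, c M * ZMod.stdAddChar (Matrix.trace (M * ((1 : GLm p (1 + l)) : Mat p (1 + l))))) = 1 ∧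
      ∀ a ∈ H₁, ∀ b ∈ H₂, ∀ g ∈ H₃, a * b * g ≠ 1 →
        (∑ M, c M * ZMod.stdAddChar
          (Matrix.trace (M * ((a * b * g : GLm p (1 + l)) : Mat p (1 + l))))) = 0)
    (hlt : budget p (1 + l) 1 (2 + ε) <
      ((Nat.card H₁ * Nat.card H₂ * Nat.card H₃ : ℕ) : ℝ) ^ ((2 + ε) / 3)) :
    (∀ K ≤ H₁, ∀ τ : K →* ℂˣ, τ ≠ 1 → Nat.card (AdmOrb K τ) ≤ 3 → K = H₁) ∧
      (∀ K ≤ H₂, ∀ τ : K →* ℂˣ, τ ≠ 1 → K.relIndex H₂ ≤ Nat.card (AdmOrb K τ)) ∧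
      (∀ K ≤ H₃, ∀ τ : K →* ℂˣ, τ ≠ 1 → Nat.card (AdmOrb K τ) ≤ 3 → K = H₃) := by
  obtain ⟨⟨hxb, -, -⟩, ⟨hyb, -⟩, ⟨hzb, -, -⟩⟩ := levelOne_member_window hl hp3 hε hε1 htpp hdes hlt
  obtain ⟨f, hf, h1, h0⟩ := exists_test hdes
  have hbp := succ_le_b (p := p) hl
  have hb4 : 4 ≤ (p ^ (1 + l) - 1) / (p - 1) := by omega
  refine ⟨fun K hK τ hτ hν => ?_, fun K hK τ hτ => ?_, fun K hK τ hτ hν => ?_⟩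
  · have hlaw := law_left htpp hf h1 h0 hK hτ
    rw [card_proj_eq] at hlaw
    have hr := arith_rigid hb4 hzb hyb hν hlaw
    have hcr := FreeModuleLaw.card_mul_relIndex hK
    have hx1 := one_le_card H₁
    have hr1 : K.relIndex H₁ = 1 := by
      rcases Nat.le_one_iff_eq_zero_or_eq_one.1 hr with h | h
      · rw [h, mul_zero] at hcr; omega
      · exact h
    rw [hr1, mul_one] at hcr
    exact Subgroup.eq_of_le_of_card_ge hK hcr.symm.le
  · have hlaw := law_middle htpp hf h1 h0 hK hτ
    rw [card_proj_eq] at hlaw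
    have hx0 : 0 < Nat.card H₁ := one_le_card H₁
    exact Nat.le_of_mul_le_mul_left
      (hlaw.trans ((Nat.mul_le_mul_left _ hxb).trans_eq (mul_comm _ _))) hx0
  · have hlaw := law_right htpp hf h1 h0 hK hτ
    rw [card_proj_eq] at hlaw
    have hr := arith_rigid hb4 hxb hyb hν hlaw
    have hcr := FreeModuleLaw.card_mul_relIndex hK
    have hz1 := one_le_card H₃
    have hr1 : K.relIndex H₃ = 1 := by
      rcases Nat.le_one_iff_eq_zero_or_eq_one.1 hr with h | h
      · rw [h, mul_zero] at hcr; omega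
      · exact h
    rw [hr1, mul_one] at hcr
    exact Subgroup.eq_of_le_of_card_ge hK hcr.symm.le

end Exclusion

end CharacterLaw
end Summit.MatrixMultiplication.MatrixMultiplication.Theorems.SubgroupIdentityDesigns.Negative

end
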